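import Summits.QuantumFields.YangMills.Theorems.BalabanUVNodesN19OscillatingLinksMomentDiscrepancy

/-!
# YM-DAG node N19 (= NE7 proper) — THE GENERAL LIPSCHITZ LINK OF THE ℓ¹-NORM BY NESTING (degree model): `dist_∞(h(Σ_{i≤d}|x_i|), Π_{4mM}) ≤
# dπ∕M + 2dπ∕m` for every 1-Lipschitz `h` — the baseline `≲ d∕√t` of (v′), and its law-level face

Cell `pub-ymgap`, HUMAN RULING D-0062 (Track A) ∕ D-0149 (work-bound push), R141 (C) wider-strategy seat `pub-ymgap-dag-n19-e` (strategy
s3 = ALTERNATIVE CURRENCY), generation g30, module 14 (lineage module 131).  Route `Summits/QuantumFields/YangMills/Theses/BalabanUVNodes.lean`,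
cluster item K3⁸ «SpineGivenEndpointR13SepCoPHV» (stmt-QuantumFields-27366); filed `--supports` that item `--as helper` (it proves no registered
stub).  COUNT-NEUTRAL: [folklore] over Mathlib and the lineage BY NAME — PART 2 `…N19SingleModeL1Norm` (`exists_additiveJackson`), module 111
`…N19JointLawPriceCompositionsLipschitz` (`exists_jacksonPoly_near`), module 117 `…N19JacksonAbsolutePowers` (`eval_plantIn`, `totalDegree_plantIn_le`),
PART 6 `…N19OscillatingLinksMomentDiscrepancy` (`abs_integral_sub_integral_le_of_near`, `continuous_l1Norm`); TOY laws under HYPOTHESES in §2; no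
scheme object, no Theses import; NOT a discharge claim.

PURPOSE.  HOME `numerics/OPEN-PROBLEM.md` records as KNOWN the nesting bound `E_d(t) ≲ d∕√t` for the general 1-Lipschitz link (module 111 in the
MOMENT currency).  This module types it in the DEGREE model of PARTS 1–7, so that the lineage's (v′) table has its baseline row in the same language:
§1 ★ `exists_mvPolynomial_near_lipschitzLink_l1Norm`: for `h : ℝ → ℝ` 1-Lipschitz and `m, M ≥ 4`, an `MvPolynomial` of total degree `≤ 4mM` within
`dπ∕M + 2dπ∕m` of `h(Σ_i|x_i|)` on `[−1,1]^ι` (module 111's Jackson polynomial of `u ↦ h(2du)` on `[−1,1]`, degree `2m`, error `2dπ∕m`, planted in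
`A∕(2d)` where `A` is PART 2's additive Jackson approximant of degree `2M`, `|S − A| ≤ dπ∕M ≤ d`, so `A ∈ [−d, 2d]`).  READING: `m = M`, `t = 4m²`:
**`dist_∞(h(Σ_{i≤d}|x_i|), Π_t) ≤ 6πd∕√t`** for every 1-Lipschitz link — against `≲ d·log²t∕t` for the classes of PARTS 2b–7.  §2 ★
`abs_integral_lipschitzLink_l1Norm_sub_le_of_moments`: the law-level face (`≤ 2(dπ∕M + 2dπ∕m)` for laws agreeing on `Π_{4mM}`).

HONEST FRAMING (binding).  Elementary and [folklore]; ONE-SIDED; NO consumer in the DAG today; nothing of Bałaban's instantiated; NE7 NOT PRINTED, NOT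
proved; N19 NOT discharged; count-neutral.  One finite `T⁴` programme at fixed `ε`; nothing continuum ∕ `ℝ⁴` ∕ OS ∕ mass-gap ∕ Clay.  0 `def` ∕ 0 `sorry`.
-/

noncomputable section

open Real Finset MeasureTheory

namespace Summit.QuantumFields.YangMills.Theorems.BalabanUVNodesN19LipschitzLinksNesting

open Summit.QuantumFields.YangMills.Theorems.BalabanUVNodesN19SingleModeL1Norm (exists_additiveJackson)
open Summit.QuantumFields.YangMills.Theorems.BalabanUVNodesN19JointLawPriceCompositionsLipschitz (exists_jacksonPoly_near)
open Summit.QuantumFields.YangMills.Theorems.BalabanUVNodesN19JacksonAbsolutePowers (eval_plantIn totalDegree_plantIn_le)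
open Summit.QuantumFields.YangMills.Theorems.BalabanUVNodesN19OscillatingLinksMomentDiscrepancy
  (abs_integral_sub_integral_le_of_near continuous_l1Norm)

variable {ι : Type*} [Fintype ι]

/-! ## §1 ★ Nesting in the degree model [folklore] -/

/-- ★ **THE GENERAL LIPSCHITZ LINK BY NESTING.**  For `h : ℝ → ℝ` with `|h(a) − h(b)| ≤ |a − b|`, `ι` nonempty (`d = |ι|`) and `m ≥ 1`, `M ≥ 4`
there is `P : MvPolynomial ι ℝ` of total degree `≤ 4mM` with `|h(Σ_i|x_i|) − P(x)| ≤ dπ∕M + 2dπ∕m` on `[−1,1]^ι`.  READING: `m = M = √t∕2` gives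
`6πd∕√t` — the baseline of (v′). [folklore] -/
theorem exists_mvPolynomial_near_lipschitzLink_l1Norm [Nonempty ι] {h : ℝ → ℝ} (hh : ∀ a b : ℝ, |h a - h b| ≤ |a - b|)
    {m M : ℕ} (hm : 0 < m) (hM : 4 ≤ M) :
    ∃ P : MvPolynomial ι ℝ, P.totalDegree ≤ 4 * m * M ∧
      ∀ x : ι → ℝ, (∀ i, x i ∈ Set.Icc (-1 : ℝ) 1) →
        |h (∑ i, |x i|) - MvPolynomial.eval x P| ≤ Fintype.card ι * π / M + 2 * Fintype.card ι * π / m := by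
  set d : ℝ := (Fintype.card ι : ℝ) with hd
  have hdpos : 0 < d := by rw [hd]; exact_mod_cast (Fintype.card_pos (α := ι))
  have hπ := Real.pi_pos
  have hM0 : 0 < M := lt_of_lt_of_le (by norm_num) hM
  -- the additive Jackson approximant
  obtain ⟨A, hAdeg, hAerr⟩ := exists_additiveJackson (ι := ι) hM0
  -- the Jackson polynomial of `u ↦ h(2du)` on `[-1,1]`
  have hK : ∀ u v : ℝ, u ∈ Set.Icc (-1 : ℝ) 1 → v ∈ Set.Icc (-1 : ℝ) 1 →
      |h (2 * d * u) - h (2 * d * v)| ≤ 2 * d * |u - v| := fun u v _ _ => by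
    refine (hh _ _).trans ?_
    rw [← mul_sub, abs_mul, abs_of_pos (by positivity)]
  have hG : ∀ u : ℝ, u ∈ Set.Icc (-1 : ℝ) 1 → |h (2 * d * u)| ≤ |h 0| + 2 * d := fun u hu => by
    have := hh (2 * d * u) 0
    rw [sub_zero, abs_mul, abs_of_pos (by positivity : (0 : ℝ) < 2 * d)] at this
    have hu1 : |u| ≤ 1 := abs_le.2 ⟨hu.1, hu.2⟩
    calc |h (2 * d * u)| = |h 0 + (h (2 * d * u) - h 0)| := by ring_nf
      _ ≤ |h 0| + |h (2 * d * u) - h 0| := abs_add_le _ _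
      _ ≤ |h 0| + 2 * d := by nlinarith
  obtain ⟨q, hqdeg, hqerr, -, -⟩ := exists_jacksonPoly_near (by positivity : (0 : ℝ) ≤ 2 * d) hK hG hm
  -- plant `q` in `A/(2d)`
  set B : MvPolynomial ι ℝ := MvPolynomial.C (1 / (2 * d)) * A with hB
  have hBdeg : B.totalDegree ≤ 2 * M :=
    (MvPolynomial.totalDegree_mul _ _).trans (by rw [MvPolynomial.totalDegree_C, zero_add]; exact hAdeg)
  refine ⟨∑ k ∈ range (q.natDegree + 1), MvPolynomial.C (q.coeff k) * B ^ k, ?_, fun x hx => ?_⟩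
  · calc (∑ k ∈ range (q.natDegree + 1), MvPolynomial.C (q.coeff k) * B ^ k).totalDegree ≤ q.natDegree * B.totalDegree :=
          totalDegree_plantIn_le q B
      _ ≤ 2 * m * (2 * M) := Nat.mul_le_mul hqdeg hBdeg
      _ = 4 * m * M := by ring
  · have hS := hAerr x hx
    rw [← hd] at hS
    have hS0 : 0 ≤ ∑ i, |x i| := Finset.sum_nonneg fun i _ => abs_nonneg _
    have hS1 : ∑ i, |x i| ≤ d := by
      calc ∑ i, |x i| ≤ ∑ _i : ι, (1 : ℝ) := Finset.sum_le_sum fun i _ => abs_le.2 ⟨(hx i).1, (hx i).2⟩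
        _ = d := by rw [sum_const, card_univ, nsmul_eq_mul, mul_one]
    -- `A(x)/(2d) ∈ [-1,1]` since `|S − A| ≤ dπ/M ≤ d`
    have hπM : π / M ≤ 1 := by
      rw [div_le_one (by exact_mod_cast hM0)]
      have : (4 : ℝ) ≤ M := by exact_mod_cast hM
      linarith [Real.pi_le_four]
    have hAd : |(∑ i, |x i|) - MvPolynomial.eval x A| ≤ d := by
      calc _ ≤ d * (π / M) := hS
        _ ≤ d * 1 := mul_le_mul_of_nonneg_left hπM hdpos.le
        _ = d := mul_one _
    have hu : MvPolynomial.eval x A / (2 * d) ∈ Set.Icc (-1 : ℝ) 1 := by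
      have h2d : (0 : ℝ) < 2 * d := by positivity
      constructor
      · rw [le_div_iff₀ h2d]; linarith [(abs_le.1 hAd).1, (abs_le.1 hAd).2]
      · rw [div_le_iff₀ h2d]; linarith [(abs_le.1 hAd).1, (abs_le.1 hAd).2]
    have hev : MvPolynomial.eval x (∑ k ∈ range (q.natDegree + 1), MvPolynomial.C (q.coeff k) * B ^ k) =
        q.eval (MvPolynomial.eval x A / (2 * d)) := by
      rw [eval_plantIn, hB, map_mul, MvPolynomial.eval_C]
      congr 1; ring
    rw [hev]
    have h1 : |h (∑ i, |x i|) - h (MvPolynomial.eval x A)| ≤ d * π / M := by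
      refine (hh _ _).trans ?_
      calc _ ≤ d * (π / M) := hS
        _ = d * π / M := by ring
    have h2 : |h (MvPolynomial.eval x A) - q.eval (MvPolynomial.eval x A / (2 * d))| ≤ 2 * d * π / m := by
      have := hqerr _ hu
      rw [show 2 * d * (MvPolynomial.eval x A / (2 * d)) = MvPolynomial.eval x A by field_simp] at this
      calc _ ≤ 2 * d * (π / m) := this
        _ = 2 * d * π / m := by ring
    calc |h (∑ i, |x i|) - q.eval (MvPolynomial.eval x A / (2 * d))|
        ≤ |h (∑ i, |x i|) - h (MvPolynomial.eval x A)| + |h (MvPolynomial.eval x A) - q.eval (MvPolynomial.eval x A / (2 * d))| :=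
          abs_sub_le _ _ _
      _ ≤ d * π / M + 2 * d * π / m := add_le_add h1 h2

/-! ## §2 ★ The law-level face [folklore] -/

/-- ★ **GENERAL LIPSCHITZ LINKS, LAW LEVEL.**  For probability laws `P₁, P₂` on `ℝ^ι` carried by `[−1,1]^ι` with EQUAL mixed moments of total degree
`≤ 4mM` (`m ≥ 1`, `M ≥ 4`) and `h` 1-Lipschitz: `|∫h(Σ_i|x_i|)dP₁ − ∫h(Σ_i|x_i|)dP₂| ≤ 2(dπ∕M + 2dπ∕m)` — the `W₁` form of (v′) at the baseline
`≲ d∕√t`. [folklore] -/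
theorem abs_integral_lipschitzLink_l1Norm_sub_le_of_moments [Nonempty ι] {P₁ P₂ : Measure (ι → ℝ)} [IsProbabilityMeasure P₁]
    [IsProbabilityMeasure P₂]
    (hP₁ : P₁ (Set.pi Set.univ (fun _ : ι => Set.Icc (-1 : ℝ) 1))ᶜ = 0) (hP₂ : P₂ (Set.pi Set.univ (fun _ : ι => Set.Icc (-1 : ℝ) 1))ᶜ = 0)
    {m M : ℕ} (hm : 0 < m) (hM : 4 ≤ M)
    (hmom : ∀ j : ι → ℕ, ∑ i, j i ≤ 4 * m * M → ∫ x, ∏ i, x i ^ j i ∂P₁ = ∫ x, ∏ i, x i ^ j i ∂P₂)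
    {h : ℝ → ℝ} (hh : ∀ a b : ℝ, |h a - h b| ≤ |a - b|) :
    |∫ x, h (∑ i, |x i|) ∂P₁ - ∫ x, h (∑ i, |x i|) ∂P₂| ≤
      2 * (Fintype.card ι * π / M + 2 * Fintype.card ι * π / m) := by
  obtain ⟨F, hF, happ⟩ := exists_mvPolynomial_near_lipschitzLink_l1Norm (ι := ι) hh hm hM
  have hcont : Continuous h := by
    refine continuous_iff_continuousAt.2 fun a => ?_
    refine Metric.continuousAt_iff.2 fun ε hε => ⟨ε, hε, fun b hb => ?_⟩
    rw [Real.dist_eq] at hb ⊢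
    exact (hh b a).trans_lt hb
  have hg : Continuous fun x : ι → ℝ => h (∑ i, |x i|) := hcont.comp continuous_l1Norm
  exact abs_integral_sub_integral_le_of_near hP₁ hP₂ hmom hg hF happ

end Summit.QuantumFields.YangMills.Theorems.BalabanUVNodesN19LipschitzLinksNesting

end
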